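import Summits.AtomisticToContinuum.HydrodynamicLimit.Theorems.CollisionIsometryCLTAdaptedWeightCLTBHContactToMassFlowIdle
import Summits.AtomisticToContinuum.HydrodynamicLimit.Theorems.CollisionIsometryCLTAdaptedWeightCLTBHContactToMassMass
import Summits.AtomisticToContinuum.HydrodynamicLimit.Theorems.CollisionIsometryCLTAdaptedWeightCLTSAWindowOfUI
import Summits.AtomisticToContinuum.HydrodynamicLimit.Theorems.DiffuseBackwardInfluence.Negative.RowBudget

/-!
# Stub `stub_contactToMass` (S4) of the line `block-h-dissipation-closure`, helper file 9: H1 INTEGRATED OVER THE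
WINDOW ENDS — the idle mass-time of the horizon vanishes in probability
(crux `CollisionIsometryCLT.AdaptedWeightCLT`, stmt-AtomisticToContinuum-14868; `--supports`, anchor
`bhContactToMass_windows_anchor`)

H1 (`DiffuseAt`) bounds the mean window ipr `E_N[iprF(Φ_{s−Δ_N} z, Δ_N)] → 0` at every FIXED window end `s > 0`;
the charging argument of `stub_contactToMass` needs it integrated over the window ends `s ∈ [0, t]` of the horizon
(the LAZY points of the mass clock are charged to the idle density, whose space integral is the flow-idle fraction
`≤ idleFrac ≤ iprF/9` of the window ending at the current time). This file is that bookkeeping, on the template of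
`SustainedAnisotropy.stub_windowOfUI`:
* `iprF_le_nine`, `iprF_nonneg` (the window ipr lies in `[0, 9]`: tree `DiffuseBackwardInfluenceNeg.ipr_le_nine`);
* `tendsto_lintegral_window_iprF` — DOMINATED CONVERGENCE in the window end:
  `∫_{[0,t]} E_N[iprF(Φ_{s−Δ_N} z, Δ_N)] ds → 0` for every admissible window sequence (integrand `≤ 9`, `→ 0` for
  each `s > 0` by H1, `s = 0` is null; measurability in `s` through the jointly measurable modification `iprMod` of
  `…SAWindowMeasurable`, which is the window ipr on the good set);
* `tendsto_lintegral_iprTime` — TONELLI: `E_N[∫_{[0,t]} iprMod ds] → 0`, and MARKOV: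
  `P_N{c ≤ ∫_{[0,t]} iprF(Φ_{s−Δ_N} z, Δ_N) ds} → 0` for every `c > 0` (`tendsto_measure_iprTime_ge`), the real
  integral along good orbits being the honest one (`iprTime_eq_of_mem`);
* the dictionary to idle MASS: `∫ₓ (N+1)⁻¹ Σ_{i idle in (s−Δ,s]} ψ_N(x_i − x) dx = flowIdleFrac ≤ iprF(Φ_{s−Δ} z, Δ)/9`
  on the good set (`integral_idleDens`, `integral_idleDens_le`).
-/

namespace Summit.AtomisticToContinuum.HydrodynamicLimit.Theorems.BlockHDissipation

open scoped BigOperators Topology Classical MeasureTheory ENNReal InnerProductSpace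
open Filter Set MeasureTheory
open Literature.Analysis.FluidPDE
open Summit.AtomisticToContinuum.HydrodynamicLimit.Theorems.ContactSourceDuhamel (T3 V3 Cfg Vel Flow Flows iprF)
open Summit.AtomisticToContinuum.HydrodynamicLimit.Theorems.ContactSourceDuhamel.TimeLocal
open Summit.AtomisticToContinuum.HydrodynamicLimit.Theorems.SustainedAnisotropy.WindowOfUI (fmod fmod_of_mem
  measurable_fmod iprMod measurable_iprMod iprF_eq_of_mem measurable_iprF)
open Summit.AtomisticToContinuum.HydrodynamicLimit.Theorems.DiffuseBackwardInfluenceNeg (idleFrac)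
open Literature.MathematicalPhysics.KineticTheory (hsDiameter hsDiameter_le localGibbsLaw isProbabilityMeasure_localGibbsLaw
  ae_mem_good_localGibbsLaw)

noncomputable section

namespace ContactToMass

variable {σ : ℝ} {N : ℕ}

/-! ## Range of the window ipr -/

/-- The window ipr is at most `9` (three unit rows of an orthogonal transfer). -/
theorem iprF_le_nine (σ : ℝ) (N : ℕ) (y : Cfg N) (Δ : ℝ) : iprF σ N y Δ ≤ 9 := by
  rw [iprF_eq_ipr]
  exact DiffuseBackwardInfluenceNeg.ipr_le_nine y Δ

/-- The window ipr is nonnegative. -/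
theorem iprF_nonneg (σ : ℝ) (N : ℕ) (y : Cfg N) (Δ : ℝ) : 0 ≤ iprF σ N y Δ := by
  unfold iprF
  positivity

/-- `iprMod ∈ [0, 9]`. -/
theorem iprMod_mem_Icc (Φ : Flows σ) (N : ℕ) (Δ s : ℝ) (z : Cfg N) : iprMod Φ N Δ s z ∈ Icc (0 : ℝ) 9 :=
  ⟨iprF_nonneg _ _ _ _, iprF_le_nine _ _ _ _⟩

/-! ## The H1 integrand through the modification -/

/-- The time-integrated window ipr of a datum through the modification: `∫_{[0,t]} iprMod ds` (lower integral). -/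
def iprTime (Φ : Flows σ) (N : ℕ) (Δ t : ℝ) (z : Cfg N) : ℝ≥0∞ :=
  ∫⁻ s in Icc 0 t, ENNReal.ofReal (iprMod Φ N Δ s z)

/-- `(s, z) ↦ ofReal (iprMod)` is jointly measurable. -/
theorem measurable_ofReal_iprMod (Φ : Flows σ) (hG : (Torus.geometry (Fin 3)).IsHardSphereRegular (hsDiameter σ N))
    (Δ : ℝ) : Measurable fun p : ℝ × Cfg N => ENNReal.ofReal (iprMod Φ N Δ p.1 p.2) :=
  (measurable_iprMod Φ hG Δ).ennreal_ofReal

/-- `iprTime` is measurable in the datum. -/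
theorem measurable_iprTime (Φ : Flows σ) (hG : (Torus.geometry (Fin 3)).IsHardSphereRegular (hsDiameter σ N))
    (Δ t : ℝ) : Measurable (iprTime Φ N Δ t) := by
  unfold iprTime
  exact (measurable_ofReal_iprMod Φ hG Δ).lintegral_prod_left'

/-- The mean of the H1 integrand at a fixed window end is measurable in the window end. -/
theorem measurable_lintegral_iprMod (Φ : Flows σ) (hG : (Torus.geometry (Fin 3)).IsHardSphereRegular (hsDiameter σ N))
    (P : Measure (Cfg N)) [SFinite P] (Δ : ℝ) :
    Measurable fun s : ℝ => ∫⁻ z, ENNReal.ofReal (iprMod Φ N Δ s z) ∂P :=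
  (measurable_ofReal_iprMod Φ hG Δ).lintegral_prod_right'

/-- Up to the null set `goodᶜ`, the modification IS the window ipr: the means agree. -/
theorem lintegral_iprMod_eq (Φ : Flows σ) (P : Measure (Cfg N)) (hgood : P (Φ N).goodᶜ = 0) (Δ s : ℝ) :
    ∫⁻ z, ENNReal.ofReal (iprMod Φ N Δ s z) ∂P = ∫⁻ z, ENNReal.ofReal (iprF σ N ((Φ N).flow (s - Δ) z) Δ) ∂P := by
  refine lintegral_congr_ae ?_
  have hae : ∀ᵐ z ∂P, z ∈ (Φ N).good := by
    rw [ae_iff]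
    exact hgood
  filter_upwards [hae] with z hz
  rw [iprF_eq_of_mem Φ hz]

/-- The mean of the H1 integrand is at most `9` under a probability measure. -/
theorem lintegral_iprMod_le (Φ : Flows σ) (P : Measure (Cfg N)) [IsProbabilityMeasure P] (Δ s : ℝ) :
    ∫⁻ z, ENNReal.ofReal (iprMod Φ N Δ s z) ∂P ≤ 9 := by
  calc ∫⁻ z, ENNReal.ofReal (iprMod Φ N Δ s z) ∂P ≤ ∫⁻ _, (9 : ℝ≥0∞) ∂P := by
        refine lintegral_mono fun z => ?_
        rw [show (9 : ℝ≥0∞) = ENNReal.ofReal 9 by norm_num]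
        exact ENNReal.ofReal_le_ofReal (iprF_le_nine _ _ _ _)
    _ = 9 := by rw [lintegral_const, measure_univ, mul_one]

/-- TONELLI: `E[iprTime] = ∫_{[0,t]} E[iprMod(s, ·)] ds`. -/
theorem lintegral_iprTime (Φ : Flows σ) (hG : (Torus.geometry (Fin 3)).IsHardSphereRegular (hsDiameter σ N))
    (P : Measure (Cfg N)) [SFinite P] (Δ t : ℝ) :
    ∫⁻ z, iprTime Φ N Δ t z ∂P = ∫⁻ s in Icc 0 t, ∫⁻ z, ENNReal.ofReal (iprMod Φ N Δ s z) ∂P := by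
  unfold iprTime
  exact lintegral_lintegral_swap ((measurable_ofReal_iprMod Φ hG Δ).comp measurable_swap).aemeasurable

/-! ## Dominated convergence in the window end -/

/-- DOMINATED CONVERGENCE on `[0, t]` for measurable functions bounded by a finite constant tending to `0` at every
positive time. -/
theorem tendsto_setLIntegral_of_le_const {g : ℕ → ℝ → ℝ≥0∞} (hg : ∀ N, Measurable (g N)) {C : ℝ≥0∞} (hC : C ≠ ⊤)
    (hgC : ∀ N s, g N s ≤ C) (hlim : ∀ s, 0 < s → Tendsto (fun N => g N s) atTop (𝓝 0)) (t : ℝ) :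
    Tendsto (fun N => ∫⁻ s in Icc 0 t, g N s) atTop (𝓝 0) := by
  have hae : ∀ᵐ s ∂(volume.restrict (Icc (0 : ℝ) t)), Tendsto (fun N => g N s) atTop (𝓝 ((fun _ => (0 : ℝ≥0∞)) s)) := by
    have h0 : ∀ᵐ s ∂(volume.restrict (Icc (0 : ℝ) t)), s ≠ 0 := by
      rw [ae_restrict_iff' measurableSet_Icc]
      have h : ∀ᵐ s ∂(volume : Measure ℝ), s ≠ 0 := by
        rw [ae_iff]
        simp only [not_not, setOf_eq_eq_singleton, Real.volume_singleton]
      exact h.mono fun s hs _ => hs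
    filter_upwards [h0, ae_restrict_mem measurableSet_Icc] with s hs hmem
    exact hlim s (lt_of_le_of_ne hmem.1 (Ne.symm hs))
  have h := tendsto_lintegral_of_dominated_convergence (μ := volume.restrict (Icc 0 t))
    (F := g) (f := fun _ => 0) (fun _ => C) hg (fun N => ae_of_all _ fun s => hgC N s) ?_ hae
  · simpa only [lintegral_zero] using h
  · rw [setLIntegral_const]
    exact ENNReal.mul_ne_top hC measure_Icc_lt_top.ne

/-- **H1 integrated over the window ends.** For nice profiles, `0 < σ < 1/2`, a flow family with H1 and an
admissible window sequence: `∫_{[0,t]} E_N[iprF(Φ_{s−Δ_N} z, Δ_N)] ds → 0`. -/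
theorem tendsto_lintegral_window_iprF {a₀ θ₀ : T3 → ℝ} {u₀ : T3 → V3} (hnice : NiceProfiles a₀ θ₀ u₀) (hσ : 0 < σ)
    (hσ2 : σ < 2⁻¹) {Φ : Flows σ} (hD : DiffuseAt σ a₀ θ₀ u₀ Φ) {Δ : ℕ → ℝ} (hΔ0 : ∀ N, 0 < Δ N)
    (hΔ : Tendsto Δ atTop (𝓝 0)) (hΔg : Tendsto (fun N : ℕ => Δ N * ((N + 1 : ℕ) : ℝ) ^ ((1 : ℝ) / 3)) atTop atTop)
    (t : ℝ) :
    Tendsto (fun N : ℕ => ∫⁻ s in Icc 0 t, ∫⁻ z, ENNReal.ofReal (iprF σ N ((Φ N).flow (s - Δ N) z) (Δ N))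
      ∂(localGibbsLaw σ a₀ u₀ θ₀ N (Φ N))) atTop (𝓝 0) := by
  have hσ2' : σ ≤ 1 / 2 := by rw [one_div]; exact hσ2.le
  have hPprob : ∀ N, IsProbabilityMeasure (localGibbsLaw σ a₀ u₀ θ₀ N (Φ N)) := fun N =>
    isProbabilityMeasure_localGibbsLaw hnice.1 hnice.2.1 hnice.2.2.1 hnice.2.2.2.1 hnice.2.2.2.2 hσ2' N (Φ N)
  have hgood : ∀ N, localGibbsLaw σ a₀ u₀ θ₀ N (Φ N) (Φ N).goodᶜ = 0 := fun N =>
    ae_iff.1 (ae_mem_good_localGibbsLaw σ a₀ u₀ θ₀ N (Φ N))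
  have hG : ∀ N, (Torus.geometry (Fin 3)).IsHardSphereRegular (hsDiameter σ N) := fun N =>
    Torus.isHardSphereRegular_geometry ((hsDiameter_le hσ.le N).trans_lt hσ2)
  -- route through the modification
  set g : ℕ → ℝ → ℝ≥0∞ := fun N s => ∫⁻ z, ENNReal.ofReal (iprMod Φ N (Δ N) s z)
    ∂(localGibbsLaw σ a₀ u₀ θ₀ N (Φ N)) with hg
  have hfg : ∀ N s, g N s = ∫⁻ z, ENNReal.ofReal (iprF σ N ((Φ N).flow (s - Δ N) z) (Δ N))
      ∂(localGibbsLaw σ a₀ u₀ θ₀ N (Φ N)) := fun N s => lintegral_iprMod_eq Φ _ (hgood N) (Δ N) s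
  have heq : ∀ N, ∫⁻ s in Icc 0 t, ∫⁻ z, ENNReal.ofReal (iprF σ N ((Φ N).flow (s - Δ N) z) (Δ N))
      ∂(localGibbsLaw σ a₀ u₀ θ₀ N (Φ N)) = ∫⁻ s in Icc 0 t, g N s := fun N =>
    lintegral_congr fun s => (hfg N s).symm
  simp_rw [heq]
  refine tendsto_setLIntegral_of_le_const (C := 9) (fun N => ?_) (by norm_num) (fun N s => ?_) (fun s hs => ?_) t
  · haveI := hPprob N
    exact measurable_lintegral_iprMod Φ (hG N) _ (Δ N)
  · haveI := hPprob N
    exact lintegral_iprMod_le Φ _ (Δ N) s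
  · simp only [hfg]
    exact hD Δ hΔ0 hΔ hΔg s hs

/-- **TONELLI form**: `E_N[iprTime] → 0`. -/
theorem tendsto_lintegral_iprTime {a₀ θ₀ : T3 → ℝ} {u₀ : T3 → V3} (hnice : NiceProfiles a₀ θ₀ u₀) (hσ : 0 < σ)
    (hσ2 : σ < 2⁻¹) {Φ : Flows σ} (hD : DiffuseAt σ a₀ θ₀ u₀ Φ) {Δ : ℕ → ℝ} (hΔ0 : ∀ N, 0 < Δ N)
    (hΔ : Tendsto Δ atTop (𝓝 0)) (hΔg : Tendsto (fun N : ℕ => Δ N * ((N + 1 : ℕ) : ℝ) ^ ((1 : ℝ) / 3)) atTop atTop)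
    (t : ℝ) :
    Tendsto (fun N : ℕ => ∫⁻ z, iprTime Φ N (Δ N) t z ∂(localGibbsLaw σ a₀ u₀ θ₀ N (Φ N))) atTop (𝓝 0) := by
  have hσ2' : σ ≤ 1 / 2 := by rw [one_div]; exact hσ2.le
  have hPprob : ∀ N, IsProbabilityMeasure (localGibbsLaw σ a₀ u₀ θ₀ N (Φ N)) := fun N =>
    isProbabilityMeasure_localGibbsLaw hnice.1 hnice.2.1 hnice.2.2.1 hnice.2.2.2.1 hnice.2.2.2.2 hσ2' N (Φ N)
  have hG : ∀ N, (Torus.geometry (Fin 3)).IsHardSphereRegular (hsDiameter σ N) := fun N =>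
    Torus.isHardSphereRegular_geometry ((hsDiameter_le hσ.le N).trans_lt hσ2)
  have hgood : ∀ N, localGibbsLaw σ a₀ u₀ θ₀ N (Φ N) (Φ N).goodᶜ = 0 := fun N =>
    ae_iff.1 (ae_mem_good_localGibbsLaw σ a₀ u₀ θ₀ N (Φ N))
  have h := tendsto_lintegral_window_iprF hnice hσ hσ2 hD hΔ0 hΔ hΔg t
  refine h.congr fun N => ?_
  haveI := hPprob N
  rw [lintegral_iprTime Φ (hG N) _ (Δ N) t]
  exact lintegral_congr fun s => (lintegral_iprMod_eq Φ _ (hgood N) (Δ N) s).symm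

/-- **MARKOV form**: `P_N{c ≤ iprTime} → 0` for every `c > 0`. -/
theorem tendsto_measure_iprTime_ge {a₀ θ₀ : T3 → ℝ} {u₀ : T3 → V3} (hnice : NiceProfiles a₀ θ₀ u₀) (hσ : 0 < σ)
    (hσ2 : σ < 2⁻¹) {Φ : Flows σ} (hD : DiffuseAt σ a₀ θ₀ u₀ Φ) {Δ : ℕ → ℝ} (hΔ0 : ∀ N, 0 < Δ N)
    (hΔ : Tendsto Δ atTop (𝓝 0)) (hΔg : Tendsto (fun N : ℕ => Δ N * ((N + 1 : ℕ) : ℝ) ^ ((1 : ℝ) / 3)) atTop atTop)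
    (t : ℝ) {c : ℝ} (hc : 0 < c) :
    Tendsto (fun N : ℕ => localGibbsLaw σ a₀ u₀ θ₀ N (Φ N) {z | ENNReal.ofReal c ≤ iprTime Φ N (Δ N) t z})
      atTop (𝓝 0) := by
  have hG : ∀ N, (Torus.geometry (Fin 3)).IsHardSphereRegular (hsDiameter σ N) := fun N =>
    Torus.isHardSphereRegular_geometry ((hsDiameter_le hσ.le N).trans_lt hσ2)
  set I : ℕ → ℝ≥0∞ := fun N => ∫⁻ z, iprTime Φ N (Δ N) t z ∂(localGibbsLaw σ a₀ u₀ θ₀ N (Φ N)) with hI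
  have hI0 : Tendsto I atTop (𝓝 0) := tendsto_lintegral_iprTime hnice hσ hσ2 hD hΔ0 hΔ hΔg t
  have hlim : Tendsto (fun N => I N / ENNReal.ofReal c) atTop (𝓝 0) := by
    have h := ENNReal.Tendsto.div_const hI0 (b := ENNReal.ofReal c) (Or.inr (ENNReal.ofReal_pos.2 hc).ne')
    simpa only [ENNReal.zero_div] using h
  refine tendsto_of_tendsto_of_tendsto_of_le_of_le tendsto_const_nhds hlim (fun _ => zero_le) fun N => ?_
  have hM : AEMeasurable (iprTime Φ N (Δ N) t) (localGibbsLaw σ a₀ u₀ θ₀ N (Φ N)) :=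
    (measurable_iprTime Φ (hG N) (Δ N) t).aemeasurable
  have h := meas_ge_le_lintegral_div hM (ENNReal.ofReal_pos.2 hc).ne' ENNReal.ofReal_ne_top
    (μ := localGibbsLaw σ a₀ u₀ θ₀ N (Φ N)) (ε := ENNReal.ofReal c)
  simpa only [hI] using h

/-! ## Along a good orbit: the honest time integral, and the idle mass -/

/-- On the good set the window ipr along the orbit is measurable in the window end. -/
theorem measurable_iprF_orbit (Φ : Flows σ) (hG : (Torus.geometry (Fin 3)).IsHardSphereRegular (hsDiameter σ N))
    {z : Cfg N} (hz : z ∈ (Φ N).good) (Δ : ℝ) : Measurable fun s : ℝ => iprF σ N ((Φ N).flow (s - Δ) z) Δ := by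
  have hpair : Measurable fun s : ℝ => (s, z) := measurable_id.prodMk measurable_const
  -- (no expected type on `.comp`: the higher-order unification against the `fun s => …` form is expensive)
  have h := (measurable_iprMod Φ hG Δ).comp hpair
  have he : (fun s : ℝ => iprF σ N ((Φ N).flow (s - Δ) z) Δ) = fun s => iprMod Φ N Δ s z :=
    funext fun s => iprF_eq_of_mem Φ hz Δ s
  rw [he]
  exact h

/-- On the good set, `iprTime` is `ofReal` of the honest real integral `∫_{[0,t]} iprF(Φ_{s−Δ} z, Δ) ds`. -/
theorem iprTime_eq_of_mem (Φ : Flows σ) (hG : (Torus.geometry (Fin 3)).IsHardSphereRegular (hsDiameter σ N))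
    {z : Cfg N} (hz : z ∈ (Φ N).good) (Δ t : ℝ) :
    iprTime Φ N Δ t z = ENNReal.ofReal (∫ s in Icc 0 t, iprF σ N ((Φ N).flow (s - Δ) z) Δ) := by
  unfold iprTime
  have hint : IntegrableOn (fun s : ℝ => iprF σ N ((Φ N).flow (s - Δ) z) Δ) (Icc 0 t) := by
    refine Measure.integrableOn_of_bounded (M := 9) measure_Icc_lt_top.ne
      (measurable_iprF_orbit Φ hG hz Δ).aestronglyMeasurable (ae_of_all _ fun s => ?_)
    rw [Real.norm_eq_abs, abs_of_nonneg (iprF_nonneg _ _ _ _)]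
    exact iprF_le_nine _ _ _ _
  rw [ofReal_integral_eq_lintegral_ofReal hint (ae_of_all _ fun s => iprF_nonneg _ _ _ _)]
  refine lintegral_congr fun s => ?_
  rw [iprF_eq_of_mem Φ hz]

/-- **MARKOV, real form**: `P_N{c ≤ ∫_{[0,t]} iprF(Φ_{s−Δ_N} z, Δ_N) ds} → 0` for every `c > 0`. -/
theorem tendsto_measure_integral_iprF_ge {a₀ θ₀ : T3 → ℝ} {u₀ : T3 → V3} (hnice : NiceProfiles a₀ θ₀ u₀) (hσ : 0 < σ)
    (hσ2 : σ < 2⁻¹) {Φ : Flows σ} (hD : DiffuseAt σ a₀ θ₀ u₀ Φ) {Δ : ℕ → ℝ} (hΔ0 : ∀ N, 0 < Δ N)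
    (hΔ : Tendsto Δ atTop (𝓝 0)) (hΔg : Tendsto (fun N : ℕ => Δ N * ((N + 1 : ℕ) : ℝ) ^ ((1 : ℝ) / 3)) atTop atTop)
    (t : ℝ) {c : ℝ} (hc : 0 < c) :
    Tendsto (fun N : ℕ => localGibbsLaw σ a₀ u₀ θ₀ N (Φ N)
      {z | c ≤ ∫ s in Icc 0 t, iprF σ N ((Φ N).flow (s - Δ N) z) (Δ N)}) atTop (𝓝 0) := by
  have hG : ∀ N, (Torus.geometry (Fin 3)).IsHardSphereRegular (hsDiameter σ N) := fun N =>
    Torus.isHardSphereRegular_geometry ((hsDiameter_le hσ.le N).trans_lt hσ2)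
  have hgood : ∀ N, localGibbsLaw σ a₀ u₀ θ₀ N (Φ N) (Φ N).goodᶜ = 0 := fun N =>
    ae_iff.1 (ae_mem_good_localGibbsLaw σ a₀ u₀ θ₀ N (Φ N))
  refine tendsto_of_tendsto_of_tendsto_of_le_of_le tendsto_const_nhds
    (tendsto_measure_iprTime_ge hnice hσ hσ2 hD hΔ0 hΔ hΔg t hc) (fun _ => zero_le) fun N => ?_
  have hsub : {z | c ≤ ∫ s in Icc 0 t, iprF σ N ((Φ N).flow (s - Δ N) z) (Δ N)} ⊆
      {z | ENNReal.ofReal c ≤ iprTime Φ N (Δ N) t z} ∪ (Φ N).goodᶜ := by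
    intro z hz
    by_cases hg : z ∈ (Φ N).good
    · left
      simp only [mem_setOf_eq] at hz ⊢
      rw [iprTime_eq_of_mem Φ (hG N) hg]
      exact ENNReal.ofReal_le_ofReal hz
    · exact Or.inr hg
  calc localGibbsLaw σ a₀ u₀ θ₀ N (Φ N) {z | c ≤ ∫ s in Icc 0 t, iprF σ N ((Φ N).flow (s - Δ N) z) (Δ N)}
      ≤ localGibbsLaw σ a₀ u₀ θ₀ N (Φ N) ({z | ENNReal.ofReal c ≤ iprTime Φ N (Δ N) t z} ∪ (Φ N).goodᶜ) :=
        measure_mono hsub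
    _ ≤ localGibbsLaw σ a₀ u₀ θ₀ N (Φ N) {z | ENNReal.ofReal c ≤ iprTime Φ N (Δ N) t z} +
          localGibbsLaw σ a₀ u₀ θ₀ N (Φ N) (Φ N).goodᶜ := measure_union_le _ _
    _ = _ := by rw [hgood N, add_zero]

/-! ## The idle mass density and its space integral -/

section Idle

variable {γc C' : ℝ} {ψ : ℕ → T3 → ℝ}

/-- The IDLE MASS DENSITY at `x` of the window `(a, b]`, weights read in the configuration `w`:
`(N+1)⁻¹ Σ_{i : no collision in (a,b]} ψ_N(x_i − x)`. -/
def idleDens (Φ : Flow σ N) (ψ : ℕ → T3 → ℝ) (a b : ℝ) (z w : Cfg N) (x : T3) : ℝ :=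
  ((N + 1 : ℕ) : ℝ)⁻¹ * ∑ i ∈ (flowIdleSet Φ a b z).toFinset, cw N ψ w x i

/-- The idle mass density is nonnegative for a nonnegative kernel family. -/
theorem idleDens_nonneg (hψ : ∀ N y, 0 ≤ ψ N y) (Φ : Flow σ N) (a b : ℝ) (z w : Cfg N) (x : T3) :
    0 ≤ idleDens Φ ψ a b z w x :=
  mul_nonneg (by positivity) (Finset.sum_nonneg fun i _ => cw_nonneg' hψ w x i)

/-- The idle mass density is at most the mass density `ρ̄ = W/(N+1)`. -/
theorem idleDens_le (hψ : ∀ N y, 0 ≤ ψ N y) (Φ : Flow σ N) (a b : ℝ) (z w : Cfg N) (x : T3) :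
    idleDens Φ ψ a b z w x ≤ ((N + 1 : ℕ) : ℝ)⁻¹ * cW N ψ w x := by
  unfold idleDens cW
  refine mul_le_mul_of_nonneg_left ?_ (by positivity)
  exact Finset.sum_le_sum_of_subset_of_nonneg (Finset.subset_univ _) fun i _ _ => cw_nonneg' hψ w x i

/-- **Space integral of the idle mass density** = the flow-idle fraction (whatever configuration the weights are
read in): `∫ₓ idleDens = flowIdleFrac Φ a b z`. -/
theorem integral_idleDens (hadm : AdmissibleKernel γc C' ψ) (Φ : Flow σ N) (a b : ℝ) (z w : Cfg N) :
    ∫ x, idleDens Φ ψ a b z w x = flowIdleFrac Φ a b z := by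
  unfold idleDens flowIdleFrac flowIdleCount
  rw [integral_sum_cw_div hadm w, Nat.card_eq_card_toFinset]

/-- On the good set, for the window `(s − Δ, s]` (`0 ≤ Δ`): `∫ₓ idleDens ≤ iprF(Φ_{s−Δ} z, Δ) / 9`. -/
theorem integral_idleDens_le (hadm : AdmissibleKernel γc C' ψ)
    (hG : (Torus.geometry (Fin 3)).IsHardSphereRegular (hsDiameter σ N)) (Φ : Flow σ N) {z : Cfg N}
    (hz : z ∈ Φ.good) (s : ℝ) {Δ : ℝ} (hΔ : 0 ≤ Δ) (w : Cfg N) :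
    ∫ x, idleDens Φ ψ (s - Δ) s z w x ≤ iprF σ N (Φ.flow (s - Δ) z) Δ / 9 := by
  rw [integral_idleDens hadm, le_div_iff₀ (by norm_num : (0 : ℝ) < 9), mul_comm]
  exact ((mul_le_mul_of_nonneg_left (flowIdleFrac_window_le hG Φ hz s hΔ) (by norm_num : (0 : ℝ) ≤ 9))).trans
    (nine_mul_idleFrac_le_iprF σ N _ Δ)

end Idle

end ContactToMass

/-- Registration anchor of this helper file (`--supports stmt-AtomisticToContinuum-14868`, stub
`stub_contactToMass`, file 9): H1 integrated over the window ends — for nice profiles, `0 < σ < 1/2`, a flow family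
with diffuse backward influence and an admissible window sequence, the local-Gibbs probability that the time-integrated
window ipr of the horizon `[0, t]` exceeds any fixed level vanishes (the `∀`-closed form of
`ContactToMass.tendsto_measure_integral_iprF_ge`). -/
theorem bhContactToMass_windows_anchor : ∀ (σ : ℝ) (a₀ θ₀ : T3 → ℝ) (u₀ : T3 → V3), NiceProfiles a₀ θ₀ u₀ → 0 < σ →
    σ < 2⁻¹ → ∀ Φ : Flows σ, DiffuseAt σ a₀ θ₀ u₀ Φ → ∀ Δ : ℕ → ℝ, (∀ N, 0 < Δ N) → Tendsto Δ atTop (𝓝 0) →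
      Tendsto (fun N : ℕ => Δ N * ((N + 1 : ℕ) : ℝ) ^ ((1 : ℝ) / 3)) atTop atTop → ∀ (t c : ℝ), 0 < c →
        Tendsto (fun N : ℕ => localGibbsLaw σ a₀ u₀ θ₀ N (Φ N)
          {z | c ≤ ∫ s in Icc 0 t, iprF σ N ((Φ N).flow (s - Δ N) z) (Δ N)}) atTop (𝓝 0) :=
  fun _ _ _ _ hnice hσ hσ2 _ hD _ hΔ0 hΔ hΔg t _ hc =>
    ContactToMass.tendsto_measure_integral_iprF_ge hnice hσ hσ2 hD hΔ0 hΔ hΔg t hc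

end

end Summit.AtomisticToContinuum.HydrodynamicLimit.Theorems.BlockHDissipation
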